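import Summits.HubbardSuperconductivity.HubbardSuperconductivity.Theorems.AnisotropyChordTransferFibre3KernelWindow

/-!
# Route `AnisotropyChord` / H0 rotor rung: PartN37 — the φ-SHIFTED hyperbolic ring resolvent sum `RingResolventSumShift` PROVED

Typed target `RingResolventSumShift` of `…Fibre3KernelWindow` (PORT PartN37 v2, theory seat `hubbard-h0-rotor-theory-1` g21,
memo 21 §315; p2's port p739260): for `μ > 0` and any phase `φ`,
`Σ_{j ∈ ℤ/L} 1/(cosh μ − cos(2πj/L + φ)) = L sinh(Lμ) / (sinh μ (cosh Lμ − cos Lφ))`.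
Proof by FINITE algebra (no series): with `w = e^{−μ+ix}`, `sinh μ/(cosh μ − cos x) = Re[(1+w)/(1−w)]` (`re_moebius`,
`hyperbolic_ratio`); `(1+w)/(1−w) = 1 + 2(Σ_{n<L} w^{n+1})/(1 − w^L)` (finite geometric sum); for `w_j = e^{−μ+i(φ+2πj/L)}`
all `w_j^L` equal `W = e^{−Lμ+iLφ}` and character orthogonality (`sum_phZ_mul`) kills the powers `1 ≤ n ≤ L−1`, so
`Σ_j (1+w_j)/(1−w_j) = L(1+W)/(1−W)`, whose real part is `L sinh(Lμ)/(cosh Lμ − cos Lφ)`.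
Prover seat `hubbard-h0-rotor-p1` g23; helper for stmt-HubbardSuperconductivity-19089 (`--supports`).
-/

set_option linter.dupNamespace false
set_option autoImplicit false

noncomputable section

open scoped BigOperators
open Complex

namespace Summit.HubbardSuperconductivity.HubbardSuperconductivity.Theorems.AnisotropyChord.Transfer.Fibre3

variable (L : ℕ) [NeZero L]

/-! ## The Möbius real part -/

omit [NeZero L] in
/-- `Re[(1 + q e^{ix})/(1 − q e^{ix})] = (1 − q²)/(1 − 2q cos x + q²)` (`0 ≤ q < 1`). [folklore] -/
theorem re_moebius (q x : ℝ) (hq0 : 0 ≤ q) (hq1 : q < 1) :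
    ((1 + (q : ℂ) * Complex.exp (x * Complex.I)) / (1 - (q : ℂ) * Complex.exp (x * Complex.I))).re
      = (1 - q ^ 2) / (1 - 2 * q * Real.cos x + q ^ 2) := by
  have hden : 0 < 1 - 2 * q * Real.cos x + q ^ 2 := by
    nlinarith [Real.cos_le_one x, Real.neg_one_le_cos x, Real.sin_sq_add_cos_sq x]
  rw [Complex.div_re]
  simp only [Complex.add_re, Complex.one_re, Complex.mul_re, Complex.ofReal_re, Complex.ofReal_im,
    Complex.exp_ofReal_mul_I_re, Complex.exp_ofReal_mul_I_im, zero_mul, sub_zero, Complex.add_im, Complex.one_im,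
    Complex.mul_im, add_zero, zero_add, Complex.sub_re, Complex.sub_im, zero_sub, Complex.normSq_apply]
  have hs := Real.sin_sq_add_cos_sq x
  rw [← add_div, div_eq_div_iff (by nlinarith) hden.ne']
  linear_combination (-q ^ 2 * (2 - 2 * q * Real.cos x)) * hs

omit [NeZero L] in
/-- `(1 − q²)/(1 − 2q cos x + q²) = sinh μ/(cosh μ − cos x)` for `q = e^{−μ}`, `μ > 0`. [folklore] -/
theorem hyperbolic_ratio (μ x : ℝ) (hμ : 0 < μ) :
    (1 - Real.exp (-μ) ^ 2) / (1 - 2 * Real.exp (-μ) * Real.cos x + Real.exp (-μ) ^ 2)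
      = Real.sinh μ / (Real.cosh μ - Real.cos x) := by
  set E := Real.exp μ with hE
  have hE0 : 0 < E := Real.exp_pos μ
  have hE1 : 1 < E := by rw [hE]; exact Real.one_lt_exp_iff.mpr hμ
  have hq : Real.exp (-μ) = E⁻¹ := by rw [Real.exp_neg]
  rw [hq, Real.sinh_eq, Real.cosh_eq, hq]
  have hc := Real.cos_le_one x
  have hden1 : 0 < 1 - 2 * E⁻¹ * Real.cos x + E⁻¹ ^ 2 := by
    have : 0 < E⁻¹ := inv_pos.mpr hE0
    have h1 : E⁻¹ < 1 := inv_lt_one_of_one_lt₀ hE1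
    nlinarith [Real.neg_one_le_cos x]
  have hden2 : 0 < (E + E⁻¹) / 2 - Real.cos x := by
    have : 2 < E + E⁻¹ := by
      have h := inv_pos.mpr hE0
      nlinarith [sq_nonneg (E - 1), mul_inv_cancel₀ hE0.ne']
    linarith
  rw [div_eq_div_iff hden1.ne' hden2.ne']
  field_simp
  ring

/-! ## The finite geometric decomposition -/

omit [NeZero L] in
/-- `(1+w)/(1−w) = 1 + 2(Σ_{n<N} w^{n+1})/(1 − w^N)` for `w ≠ 1`, `w^N ≠ 1`. [folklore] -/
theorem moebius_geom {w : ℂ} (hw : w ≠ 1) {N : ℕ} (hwN : w ^ N ≠ 1) :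
    (1 + w) / (1 - w) = 1 + 2 * (∑ n ∈ Finset.range N, w ^ (n + 1)) / (1 - w ^ N) := by
  have hg : ∑ n ∈ Finset.range N, w ^ (n + 1) = w * ((w ^ N - 1) / (w - 1)) := by
    rw [← geom_sum_eq hw N, Finset.mul_sum]
    refine Finset.sum_congr rfl fun n _ => ?_; ring
  rw [hg]
  have h1 : (1 : ℂ) - w ≠ 0 := sub_ne_zero.mpr (Ne.symm hw)
  have h2 : (1 : ℂ) - w ^ N ≠ 0 := sub_ne_zero.mpr (Ne.symm hwN)
  have h3 : w - 1 ≠ 0 := sub_ne_zero.mpr hw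
  field_simp
  ring

/-! ## The lattice points -/

omit [NeZero L] in
/-- the phase of the `j`-th shifted lattice angle factors through the additive character: `e^{i(2πj/L + φ)} = phZ(j)·e^{iφ}`. [folklore] -/
theorem exp_angle (φ : ℝ) (j : ZMod L) :
    Complex.exp (((2 * Real.pi * j.val / L + φ : ℝ) : ℂ) * Complex.I) = phZ L j * Complex.exp ((φ : ℂ) * Complex.I) := by
  unfold phZ
  rw [← Complex.exp_add]
  congr 1
  push_cast
  ring

/-- powers of the character: `phZ(j)^m = phZ(m·j)`. [folklore] -/
theorem phZ_pow (j : ZMod L) (m : ℕ) : phZ L j ^ m = phZ L ((m : ZMod L) * j) := by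
  induction m with
  | zero => simp [phZ_zero]
  | succ m ih => rw [pow_succ, ih, ← phZ_add]; congr 1; push_cast; ring

/-- character orthogonality for powers: `Σ_j phZ(j)^m = L` if `L ∣ m`, else `0`. [folklore] -/
theorem sum_phZ_pow (m : ℕ) : ∑ j : ZMod L, phZ L j ^ m = if ((m : ZMod L)) = 0 then (L : ℂ) else 0 := by
  simp_rw [phZ_pow]
  have := sum_phZ_mul L (m : ZMod L)
  rw [← this]
  exact Finset.sum_congr rfl fun j _ => by rw [mul_comm]

/-- ★ **`RingResolventSumShift` holds.** [folklore] -/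
theorem ringResolventSumShift_holds : RingResolventSumShift L := by
  intro μ hμ φ
  have hL0 : (0 : ℝ) < L := by exact_mod_cast Nat.pos_of_ne_zero (NeZero.ne L)
  set q : ℝ := Real.exp (-μ) with hqdef
  have hq0 : 0 < q := Real.exp_pos _
  have hq1 : q < 1 := by rw [hqdef]; exact Real.exp_lt_one_iff.mpr (by linarith)
  have hsinh : 0 < Real.sinh μ := Real.sinh_pos_iff.mpr hμ
  -- the points `w_j`
  set w : ZMod L → ℂ := fun j => (q : ℂ) * Complex.exp (((2 * Real.pi * j.val / L + φ : ℝ) : ℂ) * Complex.I) with hw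
  set W : ℂ := ((q ^ L : ℝ) : ℂ) * Complex.exp ((((L : ℝ) * φ : ℝ) : ℂ) * Complex.I) with hW
  have hnorm_w : ∀ j, ‖w j‖ = q := by
    intro j; simp only [hw, norm_mul, Complex.norm_real, Complex.norm_exp_ofReal_mul_I, mul_one,
      Real.norm_of_nonneg hq0.le]
  have hw1 : ∀ j, w j ≠ 1 := by
    intro j h; have := hnorm_w j; rw [h, norm_one] at this; linarith
  have hwL : ∀ j, w j ^ L = W := by
    intro j
    simp only [hw, hW, mul_pow, exp_angle, ← Complex.exp_nat_mul, phZ_pow]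
    rw [show ((L : ℕ) : ZMod L) * j = 0 by rw [ZMod.natCast_self, zero_mul], phZ_zero, one_mul]
    push_cast; ring_nf
  have hWn : ‖W‖ = q ^ L := by
    simp only [hW, norm_mul, Complex.norm_real, Complex.norm_exp_ofReal_mul_I, mul_one]
    exact Real.norm_of_nonneg (pow_nonneg hq0.le L)
  have hW1 : W ≠ 1 := by
    intro h; have := hWn; rw [h, norm_one] at this
    have : q ^ L < 1 := pow_lt_one₀ hq0.le hq1 (NeZero.ne L)
    linarith
  -- pointwise: `sinh μ/(cosh μ − cos x_j) = Re[(1+w_j)/(1−w_j)]`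
  have hpt : ∀ j : ZMod L, Real.sinh μ / (Real.cosh μ - Real.cos (2 * Real.pi * j.val / L + φ))
      = ((1 + w j) / (1 - w j)).re := by
    intro j
    rw [hw, re_moebius _ _ hq0.le hq1, hqdef, hyperbolic_ratio μ _ hμ]
  -- the sum of the Möbius transforms
  have hsumC : ∑ j : ZMod L, (1 + w j) / (1 - w j) = (L : ℂ) * ((1 + W) / (1 - W)) := by
    have e1 : ∀ j : ZMod L, (1 + w j) / (1 - w j) = 1 + 2 * (∑ n ∈ Finset.range L, w j ^ (n + 1)) / (1 - W) := by
      intro j; rw [moebius_geom (hw1 j) (by rw [hwL j]; exact hW1), hwL j]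
    rw [Finset.sum_congr rfl fun j _ => e1 j, Finset.sum_add_distrib, Finset.sum_const, Finset.card_univ,
      nsmul_eq_mul, mul_one]
    have hcard : (Fintype.card (ZMod L) : ℂ) = (L : ℂ) := by rw [ZMod.card]
    rw [hcard]
    -- Σ_j Σ_n w_j^{n+1} = L·W
    have hinner : ∑ j : ZMod L, 2 * (∑ n ∈ Finset.range L, w j ^ (n + 1)) / (1 - W)
        = 2 * (∑ n ∈ Finset.range L, ∑ j : ZMod L, w j ^ (n + 1)) / (1 - W) := by
      rw [Finset.sum_comm, ← Finset.sum_div, ← Finset.mul_sum]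
    rw [hinner]
    have hpow : ∀ n : ℕ, ∑ j : ZMod L, w j ^ (n + 1)
        = ((q : ℂ) * Complex.exp ((φ : ℂ) * Complex.I)) ^ (n + 1) * (if (((n + 1 : ℕ) : ZMod L)) = 0 then (L : ℂ) else 0) := by
      intro n
      rw [← sum_phZ_pow, Finset.mul_sum]
      refine Finset.sum_congr rfl fun j _ => ?_
      simp only [hw, exp_angle]; ring
    simp_rw [hpow]
    -- only `n = L − 1` survives
    have hsel : ∑ n ∈ Finset.range L,
        ((q : ℂ) * Complex.exp ((φ : ℂ) * Complex.I)) ^ (n + 1) * (if (((n + 1 : ℕ) : ZMod L)) = 0 then (L : ℂ) else 0)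
        = ((q : ℂ) * Complex.exp ((φ : ℂ) * Complex.I)) ^ L * (L : ℂ) := by
      obtain ⟨m, hm⟩ : ∃ m, L = m + 1 := ⟨L - 1, by have := NeZero.ne L; omega⟩
      rw [hm, Finset.sum_range_succ]
      have hzero : ∑ n ∈ Finset.range m,
          ((q : ℂ) * Complex.exp ((φ : ℂ) * Complex.I)) ^ (n + 1) * (if (((n + 1 : ℕ) : ZMod (m + 1))) = 0 then ((m + 1 : ℕ) : ℂ) else 0)
          = 0 := by
        refine Finset.sum_eq_zero fun n hn => ?_
        have hn' := Finset.mem_range.1 hn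
        have hne : (((n + 1 : ℕ) : ZMod (m + 1))) ≠ 0 := by
          rw [Ne, ZMod.natCast_eq_zero_iff]; intro h
          exact absurd (Nat.le_of_dvd (by omega) h) (by omega)
        rw [if_neg hne, mul_zero]
      have hlast : (((m + 1 : ℕ) : ZMod (m + 1))) = 0 := ZMod.natCast_self _
      subst hm
      rw [hzero, if_pos hlast, zero_add]
    rw [hsel]
    have hWeq : ((q : ℂ) * Complex.exp ((φ : ℂ) * Complex.I)) ^ L = W := by
      rw [hW, mul_pow, ← Complex.exp_nat_mul]; push_cast; ring_nf
    rw [hWeq]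
    have h1W : (1 : ℂ) - W ≠ 0 := sub_ne_zero.mpr (Ne.symm hW1)
    field_simp
    ring
  -- real parts
  have hWre : ((1 + W) / (1 - W)).re = Real.sinh (L * μ) / (Real.cosh (L * μ) - Real.cos (L * φ)) := by
    have hQ : q ^ L = Real.exp (-(L * μ)) := by
      rw [hqdef, ← Real.exp_nat_mul]; congr 1; ring
    have hQ1 : q ^ L < 1 := pow_lt_one₀ hq0.le hq1 (NeZero.ne L)
    rw [hW, re_moebius _ _ (pow_nonneg hq0.le L) hQ1, hQ, hyperbolic_ratio (L * μ) _ (by positivity)]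
  have hre : ∑ j : ZMod L, ((1 + w j) / (1 - w j)).re
      = (L : ℝ) * (Real.sinh (L * μ) / (Real.cosh (L * μ) - Real.cos (L * φ))) := by
    rw [← Complex.re_sum, hsumC, show (L : ℂ) = ((L : ℝ) : ℂ) by norm_cast, Complex.re_ofReal_mul, hWre]
  -- divide by `sinh μ`
  have hfin : ∑ j : ZMod L, 1 / (Real.cosh μ - Real.cos (2 * Real.pi * j.val / L + φ))
      = (1 / Real.sinh μ) * ∑ j : ZMod L, Real.sinh μ / (Real.cosh μ - Real.cos (2 * Real.pi * j.val / L + φ)) := by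
    rw [Finset.mul_sum]
    refine Finset.sum_congr rfl fun j _ => ?_
    field_simp
  rw [hfin, Finset.sum_congr rfl fun j _ => hpt j, hre]
  field_simp

end Summit.HubbardSuperconductivity.HubbardSuperconductivity.Theorems.AnisotropyChord.Transfer.Fibre3

end
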